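import Summits.QuantumFields.YangMills.Theorems.FluctuationComparisonRegPrIntLS2BetaSignedCombCount
import Summits.QuantumFields.YangMills.Theorems.PoincareLipschitzOneStepLinkLipschitz
import Summits.QuantumFields.YangMills.Theorems.UnitScaleTiltAvgCurvGradWords
import Mathlib.Algebra.Order.Chebyshev
import HarnessLib

/-!
# Route `FluctuationComparisonRegPrIntL` (stmt-QuantumFields-20520), LINE g18-1 S2β LAPLACE, (T2) «off-pivot quadratic transversality of the tube» —
# THE SIGNED COMB IS LIPSCHITZ: the free-bond tree coordinates `u_V(b) = T_V(b₋)·V(b)·T_V(b₊)⁻¹` are Lipschitz in the OFF-PIVOT `dist1²`-distance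
# and invariant under rooted gauge transformations

Cell `ym3-torus` (HUMAN RULING D-0037 — YM₃ on T³ is ladder rung R3, not the Clay problem), width seat `ym3-torus-px21` g10; count-neutral helper
(`--kind proof --supports stmt-QuantumFields-20520 --as helper`).  Theorems only: 0 `def`, 0 `instance`, 0 `notation`, 0 `sorry`.

WHY.  The (T2) row of the (C3β″) chart — `c₁‖y‖² ≤ ⨅_{w residual} Σ_{ℓ ∉ pivots} dist1((σ y) ℓ · (w • U₀)ℓ⁻¹)²` — is read off the tree coordinates:
along the transversal the signed comb transporter `T := combTransporter k` (✓`…S2BetaSignedComb`) is constant and `σ` leaves `U₀` at rate `≥ c‖y‖²`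
(this seat's `…TubularChartActTransversal`), while along the residual ORBIT the free-bond coordinates `u_V(b) := T_V(b₋) · V(b) · T_V(b₊)⁻¹` do
not move at all.  What turns «distance from `U₀` in `u`-coordinates» into «distance from the orbit in the bond variables» is a LIPSCHITZ bound for
`V ↦ u_V` on the off-pivot bonds, i.e. for the comb transporter in the comb values.  This file proves exactly that, by the induction that proved
✓`continuous_pathHolZ`, made quantitative in the operator norm of `M_n(ℂ)` (`‖AB − A'B'‖ ≤ ‖A − A'‖ + ‖B − B'‖`, `‖A⁻¹ − A'⁻¹‖ = ‖A − A'‖` for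
unitaries):
* §1 one matrix letter `dist1_mul_inv_eq_norm_sub`: `dist1(A·B⁻¹) = ‖A − B‖` (the `1`-Lipschitz letters for products and inverses of unitaries are the
  landed ✓`PoincareLipschitzOneStep.norm_coe_mul_sub_le` and ✓`AvgCurvGrad.norm_coe_inv_sub_inv`, imported BY NAME);
* §2 `‖T_V(x) − T_{V'}(x)‖ ≤ N · Σ_ℓ ‖V ℓ − V' ℓ‖` (`exists_norm_combTransporter_sub_le`) and, by locality ✓`combTransporter_congr` + ✓`iterCentralBond_not_mem_combSet`,
  with the sum over the OFF-PIVOT bonds only (`exists_norm_combTransporter_sub_le_offPivot`);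
* §3 ★ `coord_gaugeAct_of_rootTrivial` (`u_{w•V} = u_V` for rooted `w`, from ✓`combTransporter_gaugeAct_of_rootTrivial`) and
  ★★ `exists_sum_dist1_coord_le_offPivot`: `Σ_{b ∉ pivots} dist1(u_V(b) · u_{V'}(b)⁻¹)² ≤ C · Σ_{ℓ ∉ pivots} dist1(V ℓ · V' ℓ⁻¹)²`.

HONEST SCOPE.  Lattice bookkeeping (finitely many products of unitaries); constants are existential and lattice-dependent (no uniformity in `L`
is claimed or needed: (T2) is a fixed-lattice row); nothing of Bałaban's analysis; (T2) ∕ LAPLACE ∕ S2β ∕ stmt-QuantumFields-20520 NOT proved here;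
rung R3 = YM₃ on T³ — NOT d = 4, NOT infinite volume, NOT a mass gap, NOT Clay.
-/

noncomputable section

open Function
open scoped Matrix.Norms.L2Operator
open Literature.MathematicalPhysics.QuantumFieldTheory.Balaban1983to89
open Literature.MathematicalPhysics.QuantumFieldTheory.Balaban1983to89.T4RootedResidualGauge (shiftN lineHol lineHol_succ rootOf)
open Literature.MathematicalPhysics.QuantumFieldTheory.Balaban1983to89.B15DeterminingSets (embIter)
open Literature.MathematicalPhysics.QuantumFieldTheory.Balaban1983to89.GaugeField (gaugeAct)
open Summit.QuantumFields.YangMills.Theorems.FluctuationComparisonRegPrIntLWregChain (iterCentralBond)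
open Summit.QuantumFields.YangMills.Theorems.FluctuationComparisonRegPrIntLS2BetaSignedComb
open Summit.QuantumFields.YangMills.Theorems.FluctuationComparisonRegPrIntLS2BetaSignedCombKill
open Summit.QuantumFields.YangMills.Theorems.FluctuationComparisonRegPrIntLS2BetaSignedCombCount

namespace Summit.QuantumFields.YangMills.Theorems.FluctuationComparisonRegPrIntLS2BetaSignedCombLipschitz

open Summit.QuantumFields.YangMills.Theorems.PoincareLipschitzOneStep (norm_coe_mul_sub_le)
open Summit.QuantumFields.YangMills.Theorems.AvgCurvGrad (norm_coe_inv_sub_inv)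

/-! ## §1  One matrix letter: the `dist1`-distance of two bond variables is their operator-norm distance -/

section MatrixLetters

variable {n : Type*} [Fintype n] [DecidableEq n]

/-- `dist1 (A · B⁻¹) = ‖A − B‖`: the `dist1`-distance of two bond variables IS their operator-norm distance (right multiplication by the unitary `B`).
[cite: Balaban1985Averaging, (19) p.21] -/
theorem dist1_mul_inv_eq_norm_sub [Nonempty n] (A B : Matrix.specialUnitaryGroup n ℂ) :
    dist1 (A * B⁻¹) = ‖(A : Matrix n n ℂ) - (B : Matrix n n ℂ)‖ := by
  have hB : star (B : Matrix n n ℂ) * (B : Matrix n n ℂ) = 1 := Matrix.mem_unitaryGroup_iff'.1 B.2.1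
  show ‖((A * B⁻¹ : Matrix.specialUnitaryGroup n ℂ) : Matrix n n ℂ) - 1‖ = _
  rw [← CStarRing.norm_mul_mem_unitary (((A * B⁻¹ : Matrix.specialUnitaryGroup n ℂ) : Matrix n n ℂ) - 1) B.2.1]
  congr 1
  rw [sub_mul, one_mul, show ((A * B⁻¹ : Matrix.specialUnitaryGroup n ℂ) : Matrix n n ℂ) = (A : Matrix n n ℂ) * star (B : Matrix n n ℂ) from rfl,
    mul_assoc, hB, mul_one]

end MatrixLetters

/-! ## §2  The holonomies and the comb transporter are Lipschitz in the bond variables -/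

section Holonomy

variable {P : Params} {j : ℕ} {n : Type*} [Fintype n] [DecidableEq n] [Nonempty n]

/-- A forward straight holonomy of `m` steps is `m`-Lipschitz in the sum of the bond distances. [cite: Balaban1985Averaging, (8) p.19 (bookkeeping)] -/
theorem norm_lineHol_sub_le (a : Site P j) (μ : Fin P.d) :
    ∀ (m : ℕ) (V V' : GaugeField P j (Matrix.specialUnitaryGroup n ℂ)),
      ‖((lineHol V a μ m : Matrix.specialUnitaryGroup n ℂ) : Matrix n n ℂ) - ((lineHol V' a μ m : Matrix.specialUnitaryGroup n ℂ) : Matrix n n ℂ)‖ ≤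
        m * ∑ ℓ : PBond P j, ‖((V ℓ : Matrix.specialUnitaryGroup n ℂ) : Matrix n n ℂ) - ((V' ℓ : Matrix.specialUnitaryGroup n ℂ) : Matrix n n ℂ)‖
  | 0, V, V' => by simp
  | m + 1, V, V' => by
      rw [lineHol_succ, lineHol_succ]
      calc _ ≤ ‖((lineHol V a μ m : Matrix.specialUnitaryGroup n ℂ) : Matrix n n ℂ) - ((lineHol V' a μ m : Matrix.specialUnitaryGroup n ℂ) : Matrix n n ℂ)‖ +
            ‖((V ⟨shiftN a μ m, μ⟩ : Matrix.specialUnitaryGroup n ℂ) : Matrix n n ℂ) - ((V' ⟨shiftN a μ m, μ⟩ : Matrix.specialUnitaryGroup n ℂ) : Matrix n n ℂ)‖ :=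
            norm_coe_mul_sub_le _ _ _ _
        _ ≤ m * (∑ ℓ : PBond P j, ‖((V ℓ : Matrix.specialUnitaryGroup n ℂ) : Matrix n n ℂ) - ((V' ℓ : Matrix.specialUnitaryGroup n ℂ) : Matrix n n ℂ)‖) +
            ∑ ℓ : PBond P j, ‖((V ℓ : Matrix.specialUnitaryGroup n ℂ) : Matrix n n ℂ) - ((V' ℓ : Matrix.specialUnitaryGroup n ℂ) : Matrix n n ℂ)‖ :=
            add_le_add (norm_lineHol_sub_le a μ m V V')
              (Finset.single_le_sum (f := fun ℓ : PBond P j =>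
                ‖((V ℓ : Matrix.specialUnitaryGroup n ℂ) : Matrix n n ℂ) - ((V' ℓ : Matrix.specialUnitaryGroup n ℂ) : Matrix n n ℂ)‖)
                (fun ℓ _ => norm_nonneg _) (Finset.mem_univ _))
        _ = ((m + 1 : ℕ) : ℝ) * ∑ ℓ : PBond P j, ‖((V ℓ : Matrix.specialUnitaryGroup n ℂ) : Matrix n n ℂ) - ((V' ℓ : Matrix.specialUnitaryGroup n ℂ) : Matrix n n ℂ)‖ := by
            push_cast; ring

/-- A backward straight holonomy of `m` steps is `m`-Lipschitz in the sum of the bond distances (inverted variables: `‖A⁻¹ − A'⁻¹‖ = ‖A − A'‖`).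
[cite: Balaban1985Averaging, (8) p.19 (bookkeeping)] -/
theorem norm_lineHolBack_sub_le (a : Site P j) (μ : Fin P.d) :
    ∀ (m : ℕ) (V V' : GaugeField P j (Matrix.specialUnitaryGroup n ℂ)),
      ‖((lineHolBack V a μ m : Matrix.specialUnitaryGroup n ℂ) : Matrix n n ℂ) - ((lineHolBack V' a μ m : Matrix.specialUnitaryGroup n ℂ) : Matrix n n ℂ)‖ ≤
        m * ∑ ℓ : PBond P j, ‖((V ℓ : Matrix.specialUnitaryGroup n ℂ) : Matrix n n ℂ) - ((V' ℓ : Matrix.specialUnitaryGroup n ℂ) : Matrix n n ℂ)‖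
  | 0, V, V' => by simp
  | m + 1, V, V' => by
      rw [lineHolBack_succ, lineHolBack_succ]
      calc _ ≤ ‖((lineHolBack V a μ m : Matrix.specialUnitaryGroup n ℂ) : Matrix n n ℂ) - ((lineHolBack V' a μ m : Matrix.specialUnitaryGroup n ℂ) : Matrix n n ℂ)‖ +
            ‖(((V ⟨shiftZ a μ (-((m : ℤ) + 1)), μ⟩)⁻¹ : Matrix.specialUnitaryGroup n ℂ) : Matrix n n ℂ) -
              (((V' ⟨shiftZ a μ (-((m : ℤ) + 1)), μ⟩)⁻¹ : Matrix.specialUnitaryGroup n ℂ) : Matrix n n ℂ)‖ :=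
            norm_coe_mul_sub_le _ _ _ _
        _ ≤ m * (∑ ℓ : PBond P j, ‖((V ℓ : Matrix.specialUnitaryGroup n ℂ) : Matrix n n ℂ) - ((V' ℓ : Matrix.specialUnitaryGroup n ℂ) : Matrix n n ℂ)‖) +
            ∑ ℓ : PBond P j, ‖((V ℓ : Matrix.specialUnitaryGroup n ℂ) : Matrix n n ℂ) - ((V' ℓ : Matrix.specialUnitaryGroup n ℂ) : Matrix n n ℂ)‖ := by
            refine add_le_add (norm_lineHolBack_sub_le a μ m V V') ?_
            rw [norm_coe_inv_sub_inv]
            exact Finset.single_le_sum (f := fun ℓ : PBond P j =>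
                ‖((V ℓ : Matrix.specialUnitaryGroup n ℂ) : Matrix n n ℂ) - ((V' ℓ : Matrix.specialUnitaryGroup n ℂ) : Matrix n n ℂ)‖)
              (fun ℓ _ => norm_nonneg _) (Finset.mem_univ _)
        _ = ((m + 1 : ℕ) : ℝ) * ∑ ℓ : PBond P j, ‖((V ℓ : Matrix.specialUnitaryGroup n ℂ) : Matrix n n ℂ) - ((V' ℓ : Matrix.specialUnitaryGroup n ℂ) : Matrix n n ℂ)‖ := by
            push_cast; ring

/-- A signed straight holonomy of `z` steps is `|z|`-Lipschitz in the sum of the bond distances. [cite: Balaban1985Averaging, (8) p.19 (bookkeeping)] -/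
theorem norm_lineHolZ_sub_le (a : Site P j) (μ : Fin P.d) :
    ∀ (z : ℤ) (V V' : GaugeField P j (Matrix.specialUnitaryGroup n ℂ)),
      ‖((lineHolZ V a μ z : Matrix.specialUnitaryGroup n ℂ) : Matrix n n ℂ) - ((lineHolZ V' a μ z : Matrix.specialUnitaryGroup n ℂ) : Matrix n n ℂ)‖ ≤
        z.natAbs * ∑ ℓ : PBond P j, ‖((V ℓ : Matrix.specialUnitaryGroup n ℂ) : Matrix n n ℂ) - ((V' ℓ : Matrix.specialUnitaryGroup n ℂ) : Matrix n n ℂ)‖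
  | Int.ofNat m, V, V' => by
      rw [show (Int.ofNat m : ℤ) = (m : ℤ) from rfl, lineHolZ_natCast, lineHolZ_natCast, Int.natAbs_natCast]
      exact norm_lineHol_sub_le a μ m V V'
  | Int.negSucc m, V, V' => by
      rw [lineHolZ_negSucc, lineHolZ_negSucc, Int.natAbs_negSucc]
      exact norm_lineHolBack_sub_le a μ (m + 1) V V'

/-- A signed coordinate path holonomy is Lipschitz in the sum of the bond distances (constant = total number of steps; existential).
[cite: Balaban1985Averaging, (8) p.19 (bookkeeping)] -/
theorem exists_norm_pathHolZ_sub_le (x : Site P j) :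
    ∀ (l : List (Fin P.d)) (a : Site P j), ∃ N : ℕ, ∀ V V' : GaugeField P j (Matrix.specialUnitaryGroup n ℂ),
      ‖((pathHolZ V a x l : Matrix.specialUnitaryGroup n ℂ) : Matrix n n ℂ) - ((pathHolZ V' a x l : Matrix.specialUnitaryGroup n ℂ) : Matrix n n ℂ)‖ ≤
        N * ∑ ℓ : PBond P j, ‖((V ℓ : Matrix.specialUnitaryGroup n ℂ) : Matrix n n ℂ) - ((V' ℓ : Matrix.specialUnitaryGroup n ℂ) : Matrix n n ℂ)‖
  | [], a => ⟨0, fun V V' => by simp [pathHolZ]⟩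
  | μ :: l, a => by
      obtain ⟨N, hN⟩ := exists_norm_pathHolZ_sub_le x l (shiftZ a μ (((x μ).val : ℤ) - ((a μ).val : ℤ)))
      refine ⟨(((x μ).val : ℤ) - ((a μ).val : ℤ)).natAbs + N, fun V V' => ?_⟩
      rw [pathHolZ, pathHolZ]
      calc _ ≤ ‖((lineHolZ V a μ (((x μ).val : ℤ) - ((a μ).val : ℤ)) : Matrix.specialUnitaryGroup n ℂ) : Matrix n n ℂ) -
              ((lineHolZ V' a μ (((x μ).val : ℤ) - ((a μ).val : ℤ)) : Matrix.specialUnitaryGroup n ℂ) : Matrix n n ℂ)‖ +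
            ‖((pathHolZ V (shiftZ a μ (((x μ).val : ℤ) - ((a μ).val : ℤ))) x l : Matrix.specialUnitaryGroup n ℂ) : Matrix n n ℂ) -
              ((pathHolZ V' (shiftZ a μ (((x μ).val : ℤ) - ((a μ).val : ℤ))) x l : Matrix.specialUnitaryGroup n ℂ) : Matrix n n ℂ)‖ :=
            norm_coe_mul_sub_le _ _ _ _
        _ ≤ (((x μ).val : ℤ) - ((a μ).val : ℤ)).natAbs *
              (∑ ℓ : PBond P j, ‖((V ℓ : Matrix.specialUnitaryGroup n ℂ) : Matrix n n ℂ) - ((V' ℓ : Matrix.specialUnitaryGroup n ℂ) : Matrix n n ℂ)‖) +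
            N * ∑ ℓ : PBond P j, ‖((V ℓ : Matrix.specialUnitaryGroup n ℂ) : Matrix n n ℂ) - ((V' ℓ : Matrix.specialUnitaryGroup n ℂ) : Matrix n n ℂ)‖ :=
            add_le_add (norm_lineHolZ_sub_le a μ _ V V') (hN V V')
        _ = (((((x μ).val : ℤ) - ((a μ).val : ℤ)).natAbs + N : ℕ) : ℝ) *
              ∑ ℓ : PBond P j, ‖((V ℓ : Matrix.specialUnitaryGroup n ℂ) : Matrix n n ℂ) - ((V' ℓ : Matrix.specialUnitaryGroup n ℂ) : Matrix n n ℂ)‖ := by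
            push_cast; ring

/-- ★ **THE SIGNED COMB TRANSPORTER IS LIPSCHITZ IN THE BOND VARIABLES**: `‖T_V(x) − T_{V'}(x)‖ ≤ N · Σ_ℓ ‖V ℓ − V' ℓ‖` for one lattice constant `N`
and all `V, V', x`. [cite: Balaban1985Variational, (19) p.281 (bookkeeping)] -/
theorem exists_norm_combTransporter_sub_le (k : ℕ) :
    ∃ N : ℕ, ∀ (V V' : GaugeField P 0 (Matrix.specialUnitaryGroup n ℂ)) (x : Site P 0),
      ‖((combTransporter k V x : Matrix.specialUnitaryGroup n ℂ) : Matrix n n ℂ) - ((combTransporter k V' x : Matrix.specialUnitaryGroup n ℂ) : Matrix n n ℂ)‖ ≤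
        N * ∑ ℓ : PBond P 0, ‖((V ℓ : Matrix.specialUnitaryGroup n ℂ) : Matrix n n ℂ) - ((V' ℓ : Matrix.specialUnitaryGroup n ℂ) : Matrix n n ℂ)‖ := by
  classical
  choose N hN using fun x : Site P 0 => exists_norm_pathHolZ_sub_le (n := n) x (List.finRange P.d) (rootOf k x)
  refine ⟨∑ x, N x, fun V V' x => ?_⟩
  have hle : (N x : ℝ) ≤ ((∑ x', N x' : ℕ) : ℝ) := by
    exact_mod_cast Finset.single_le_sum (f := N) (fun _ _ => Nat.zero_le _) (Finset.mem_univ x)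
  have hS : 0 ≤ ∑ ℓ : PBond P 0, ‖((V ℓ : Matrix.specialUnitaryGroup n ℂ) : Matrix n n ℂ) - ((V' ℓ : Matrix.specialUnitaryGroup n ℂ) : Matrix n n ℂ)‖ :=
    Finset.sum_nonneg fun _ _ => norm_nonneg _
  unfold combTransporter
  exact (hN x V V').trans (mul_le_mul_of_nonneg_right hle hS)

/-- ★ **… AND IN THE OFF-PIVOT BOND VARIABLES ONLY**: since the transporter only reads the comb values (✓`combTransporter_congr`) and no pivot
`βₖ(c)` is a comb bond (✓`iterCentralBond_not_mem_combSet`), `‖T_V(x) − T_{V'}(x)‖ ≤ N · Σ_{ℓ ∉ pivots} ‖V ℓ − V' ℓ‖`.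
[cite: Balaban1985Variational, (19) p.281 (bookkeeping); Balaban1987RG1, (0.4) p.253] -/
theorem exists_norm_combTransporter_sub_le_offPivot {k : ℕ} (hk : k ≤ P.m + P.K) :
    ∃ N : ℕ, ∀ (V V' : GaugeField P 0 (Matrix.specialUnitaryGroup n ℂ)) (x : Site P 0),
      ‖((combTransporter k V x : Matrix.specialUnitaryGroup n ℂ) : Matrix n n ℂ) - ((combTransporter k V' x : Matrix.specialUnitaryGroup n ℂ) : Matrix n n ℂ)‖ ≤
        N * ∑ ℓ ∈ Finset.univ.filter (fun ℓ : PBond P 0 => ∀ c, iterCentralBond (P := P) k c ≠ ℓ),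
          ‖((V ℓ : Matrix.specialUnitaryGroup n ℂ) : Matrix n n ℂ) - ((V' ℓ : Matrix.specialUnitaryGroup n ℂ) : Matrix n n ℂ)‖ := by
  classical
  obtain ⟨N, hN⟩ := exists_norm_combTransporter_sub_le (P := P) (n := n) k
  refine ⟨N, fun V V' x => ?_⟩
  -- replace `V'` by `V''` = `V'` on the comb, `V` elsewhere: same transporter, and `V − V''` lives on the comb ⊆ off-pivot bonds
  set V'' : GaugeField P 0 (Matrix.specialUnitaryGroup n ℂ) := fun ℓ => if ℓ ∈ (combSet k : Set (PBond P 0)) then V' ℓ else V ℓ with hV''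
  have hT : combTransporter k V' = combTransporter k V'' :=
    combTransporter_congr hk fun b hb => by simp only [hV'', if_pos hb]
  rw [hT]
  refine (hN V V'' x).trans (mul_le_mul_of_nonneg_left ?_ (Nat.cast_nonneg N))
  rw [Finset.sum_filter]
  refine Finset.sum_le_sum fun ℓ _ => ?_
  by_cases hℓ : ℓ ∈ (combSet k : Set (PBond P 0))
  · have hoff : ∀ c, iterCentralBond (P := P) k c ≠ ℓ := fun c hc => iterCentralBond_not_mem_combSet hk c (hc ▸ hℓ)
    simp only [hV'', if_pos hℓ, if_pos hoff, le_refl]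
  · simp only [hV'', if_neg hℓ, sub_self, norm_zero]
    split_ifs <;> first | exact le_refl _ | exact norm_nonneg _

end Holonomy

/-! ## §3  The free-bond tree coordinates `u_V(b) = T_V(b₋) · V(b) · T_V(b₊)⁻¹`: rooted invariance and the off-pivot Lipschitz bound -/

section Coordinates

variable {P : Params}

/-- ★ **THE FREE-BOND COORDINATES DO NOT MOVE ALONG THE ROOTED ORBIT**: for a gauge transformation `w` trivial at the `k`-block centres,
`T_{w•V}(b₋) · (w•V)(b) · T_{w•V}(b₊)⁻¹ = T_V(b₋) · V(b) · T_V(b₊)⁻¹` for EVERY bond `b` (covariance ✓`combTransporter_gaugeAct_of_rootTrivial`: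
`T_{w•V}(x) = T_V(x) · w(x)⁻¹`). [cite: Balaban1985Variational, (19) p.281; Balaban1985Averaging, (8) p.19] -/
theorem coord_gaugeAct_of_rootTrivial {G : Type*} [GaugeGroup G] (k : ℕ) {w : GaugeTransf P 0 G} (hw : ∀ y : Site P k, w (embIter k y) = 1)
    (V : GaugeField P 0 G) (b : PBond P 0) :
    combTransporter k (gaugeAct w V) b.src * gaugeAct w V b * (combTransporter k (gaugeAct w V) b.tgt)⁻¹ =
      combTransporter k V b.src * V b * (combTransporter k V b.tgt)⁻¹ := by
  rw [combTransporter_gaugeAct_of_rootTrivial k hw, combTransporter_gaugeAct_of_rootTrivial k hw]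
  simp only [gaugeAct, mul_inv_rev, inv_inv, mul_assoc, inv_mul_cancel_left]

variable {n : Type*} [Fintype n] [DecidableEq n] [Nonempty n]

/-- ★★ **THE FREE-BOND COORDINATES ARE LIPSCHITZ IN THE OFF-PIVOT `dist1²`-DISTANCE**: one lattice constant `C ≥ 0` with
`Σ_{b ∉ pivots} dist1(u_V(b) · u_{V'}(b)⁻¹)² ≤ C · Σ_{ℓ ∉ pivots} dist1(V ℓ · V' ℓ⁻¹)²` for all fine fields `V, V'`, where
`u_V(b) := T_V(b₋) · V(b) · T_V(b₊)⁻¹` and `T = combTransporter k` (per bond: `dist1 = ‖u_V(b) − u_{V'}(b)‖ ≤ ‖T_V(b₋) − T_{V'}(b₋)‖ + ‖V b − V' b‖ +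
‖T_V(b₊) − T_{V'}(b₊)‖ ≤ (2N+1)·Σ_{ℓ ∉ pivots}‖V ℓ − V' ℓ‖`, then Cauchy–Schwarz). [cite: Balaban1985Variational, (19) p.281, Thm 1 (10) p.279] -/
theorem exists_sum_dist1_coord_le_offPivot {k : ℕ} (hk : k ≤ P.m + P.K) :
    ∃ C : ℝ, 0 ≤ C ∧ ∀ V V' : GaugeField P 0 (Matrix.specialUnitaryGroup n ℂ),
      ∑ b ∈ Finset.univ.filter (fun b : PBond P 0 => ∀ c, iterCentralBond (P := P) k c ≠ b),
          dist1 ((combTransporter k V b.src * V b * (combTransporter k V b.tgt)⁻¹) *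
            (combTransporter k V' b.src * V' b * (combTransporter k V' b.tgt)⁻¹)⁻¹) ^ 2 ≤
        C * ∑ ℓ ∈ Finset.univ.filter (fun ℓ : PBond P 0 => ∀ c, iterCentralBond (P := P) k c ≠ ℓ),
          dist1 (V ℓ * (V' ℓ)⁻¹) ^ 2 := by
  classical
  obtain ⟨N, hN⟩ := exists_norm_combTransporter_sub_le_offPivot (P := P) (n := n) hk
  set OFF : Finset (PBond P 0) := Finset.univ.filter (fun ℓ : PBond P 0 => ∀ c, iterCentralBond (P := P) k c ≠ ℓ) with hOFF
  refine ⟨OFF.card * ((2 * N + 1) ^ 2 * OFF.card), by positivity, fun V V' => ?_⟩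
  -- the off-pivot `ℓ¹` and `ℓ²` bond distances
  set S : ℝ := ∑ ℓ ∈ OFF, ‖((V ℓ : Matrix.specialUnitaryGroup n ℂ) : Matrix n n ℂ) - ((V' ℓ : Matrix.specialUnitaryGroup n ℂ) : Matrix n n ℂ)‖ with hS
  set Q : ℝ := ∑ ℓ ∈ OFF, dist1 (V ℓ * (V' ℓ)⁻¹) ^ 2 with hQ
  have hQ' : Q = ∑ ℓ ∈ OFF, ‖((V ℓ : Matrix.specialUnitaryGroup n ℂ) : Matrix n n ℂ) - ((V' ℓ : Matrix.specialUnitaryGroup n ℂ) : Matrix n n ℂ)‖ ^ 2 :=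
    Finset.sum_congr rfl fun ℓ _ => by rw [dist1_mul_inv_eq_norm_sub]
  have hS0 : 0 ≤ S := Finset.sum_nonneg fun _ _ => norm_nonneg _
  have hSQ : S ^ 2 ≤ OFF.card * Q := by rw [hQ']; exact sq_sum_le_card_mul_sum_sq
  -- per bond
  have hb : ∀ b ∈ OFF, dist1 ((combTransporter k V b.src * V b * (combTransporter k V b.tgt)⁻¹) *
      (combTransporter k V' b.src * V' b * (combTransporter k V' b.tgt)⁻¹)⁻¹) ^ 2 ≤ (2 * N + 1) ^ 2 * OFF.card * Q := by
    intro b hbO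
    rw [dist1_mul_inv_eq_norm_sub]
    have h1 : ‖((combTransporter k V b.src * V b * (combTransporter k V b.tgt)⁻¹ : Matrix.specialUnitaryGroup n ℂ) : Matrix n n ℂ) -
        ((combTransporter k V' b.src * V' b * (combTransporter k V' b.tgt)⁻¹ : Matrix.specialUnitaryGroup n ℂ) : Matrix n n ℂ)‖ ≤ (2 * N + 1) * S := by
      calc _ ≤ ‖((combTransporter k V b.src * V b : Matrix.specialUnitaryGroup n ℂ) : Matrix n n ℂ) -
                ((combTransporter k V' b.src * V' b : Matrix.specialUnitaryGroup n ℂ) : Matrix n n ℂ)‖ +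
              ‖(((combTransporter k V b.tgt)⁻¹ : Matrix.specialUnitaryGroup n ℂ) : Matrix n n ℂ) -
                (((combTransporter k V' b.tgt)⁻¹ : Matrix.specialUnitaryGroup n ℂ) : Matrix n n ℂ)‖ := norm_coe_mul_sub_le _ _ _ _
        _ ≤ (‖((combTransporter k V b.src : Matrix.specialUnitaryGroup n ℂ) : Matrix n n ℂ) - ((combTransporter k V' b.src : Matrix.specialUnitaryGroup n ℂ) : Matrix n n ℂ)‖ +
              ‖((V b : Matrix.specialUnitaryGroup n ℂ) : Matrix n n ℂ) - ((V' b : Matrix.specialUnitaryGroup n ℂ) : Matrix n n ℂ)‖) +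
              ‖((combTransporter k V b.tgt : Matrix.specialUnitaryGroup n ℂ) : Matrix n n ℂ) - ((combTransporter k V' b.tgt : Matrix.specialUnitaryGroup n ℂ) : Matrix n n ℂ)‖ := by
              rw [norm_coe_inv_sub_inv]
              exact add_le_add (norm_coe_mul_sub_le _ _ _ _) le_rfl
        _ ≤ (N * S + S) + N * S := by
              refine add_le_add (add_le_add (hN V V' b.src) ?_) (hN V V' b.tgt)
              exact Finset.single_le_sum (f := fun ℓ : PBond P 0 =>
                ‖((V ℓ : Matrix.specialUnitaryGroup n ℂ) : Matrix n n ℂ) - ((V' ℓ : Matrix.specialUnitaryGroup n ℂ) : Matrix n n ℂ)‖)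
                (fun ℓ _ => norm_nonneg _) hbO
        _ = (2 * N + 1) * S := by ring
    have h0 : 0 ≤ ‖((combTransporter k V b.src * V b * (combTransporter k V b.tgt)⁻¹ : Matrix.specialUnitaryGroup n ℂ) : Matrix n n ℂ) -
        ((combTransporter k V' b.src * V' b * (combTransporter k V' b.tgt)⁻¹ : Matrix.specialUnitaryGroup n ℂ) : Matrix n n ℂ)‖ := norm_nonneg _
    calc _ ≤ ((2 * N + 1) * S) ^ 2 := pow_le_pow_left₀ h0 h1 2
      _ = (2 * N + 1) ^ 2 * S ^ 2 := by ring
      _ ≤ (2 * N + 1) ^ 2 * (OFF.card * Q) := by gcongr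
      _ = (2 * N + 1) ^ 2 * OFF.card * Q := by ring
  calc _ ≤ OFF.card • ((2 * N + 1) ^ 2 * OFF.card * Q) := Finset.sum_le_card_nsmul _ _ _ hb
    _ = OFF.card * ((2 * N + 1) ^ 2 * OFF.card) * Q := by rw [nsmul_eq_mul]; ring

end Coordinates

end Summit.QuantumFields.YangMills.Theorems.FluctuationComparisonRegPrIntLS2BetaSignedCombLipschitz

end
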